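import Mathlib
import Literature.MathematicalPhysics.QuantumFieldTheory.Balaban1983to89.Beta.EffectiveKernel
import Literature.MathematicalPhysics.QuantumFieldTheory.Balaban1983to89.Beta.TorusG0DivDecay
import Literature.MathematicalPhysics.QuantumFieldTheory.Balaban1983to89.Beta.PoissonInterior

/-!
# Beta / TransportLeg — the two TRANSPORT LEGS of the background propagator `G₀ = (−Δ^η + aQ*Q)⁻¹` on the torus at
`A = 0`: mesh-uniform SUP decay `|(G₀g)(x)| ≤ K e^{−δ·dist(x, supp g)}` and GRADIENT decay with the extra factor `η`,
`|(G₀g)(x+e_μ) − (G₀g)(x)| ≤ K η e^{−δ·dist(x, supp g)}` — B4 (1.10)'s two operator-level legs for the scalar model,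
KERNEL, from Combes–Thomas set decay + the interior estimate of `Beta/PoissonInterior`

HONEST FRAMING (verbatim, page 1 of everything this cell writes): discharging `BetaPertH` makes Bałaban's UV
stability UNCONDITIONAL — a real constructive-QFT result; it is NOT the continuum limit and NOT the Clay problem.
Gloss (BETA-SPEC v1.9b l. 17–18, G-ref2-14 (a) / G-ref2-20 (a)): «UNCONDITIONAL» in [Balaban1989LargeFieldII] (B16)
p. 355's interval-hypothesis sense ONLY (`FlowStepRuns.p355Unconditional_of_partialSums` keeps `hnodes`); the located
leaves G-adv3-2, G-adv3-1 and `SecondExpLeaf` REMAIN.  THIS MODULE discharges nothing of that: it is a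
Mathlib-elementary certificate about the scalar (one-component, `U = 1`, no gauge field) site-averaged toy operator
`torusOp n M a = (n+1)²(−Δ₁) + a·Q*Q` of `Beta/TorusG0Decay` and its inverse `G0 n M a` of `Beta/TorusG0Kernel`
(both unit pv23-g3; `deltaStd` from an5-g4's `Beta/EffectiveKernel`); nothing printed by Bałaban, King or Dimock is
asserted and NO hypothesis is a quotation (ABSOLUTE RULE of the cell: zero cited facts here; every `theorem` below is
kernel-checked, tagged [folklore]).

CONTEXT (located print, NOT used as input).  [Balaban1983RegularityDecay] = B4 (Commun. Math. Phys. 89, 571–597),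
p. 573, Theorem (Proposition 2.1 of [1]), second display: «|(D^η_{A,μ}G_k(Ω,A)f)(x)|, |(G_k(Ω,A)f)(x)| ≤ c₀ exp(−δ₀
dist(x, supp f))‖f‖_∞ (1.10) for x ∈ Ω, dist(x,Ω^c) ≥ R₀», and ibid. «For some simple sets Ω, e.g. for rectangular
parallelepipeds, the inequalities hold without any restrictions on the points x, x′»; here `D^η` is the covariant
difference derivative `(∂^η_μ A)(x) = η⁻¹(A(x+ηe_μ) − A(x))` (p. 573 l. 1–2), i.e. `η⁻¹ = n+1` times the unit-lattice
forward difference — so the `η`-GAIN of the gradient leg below is exactly the statement that `D^η G_k f` is bounded.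
The expository account [Dimock2013] (arXiv:1108.1335) App. D, Lemma 33: «Let Ω be a rectangular union of M cubes.
Then with γ₀ = O(L⁻²): |(G_k(Ω)f)(x)| ≤ C e^{−γ₀ d(x, supp f)}‖f‖_∞, |(∂G_k(Ω)f)(x)| ≤ C e^{−γ₀ d(x, supp f)}‖f‖_∞, …»
(Lemma 31 ibid. for the kernel `H_k`: «[Bal83b]. First establish the result by Fourier series on the whole lattice.
Then extend the result to Ω by multiple reflections.»).  Both are PRINTED-CLAIMED steps of the manuscripts under
audit and are NOT cited; this file re-derives the `A = 0`, periodic, one-component case of the first two legs of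
(1.10) by a different (elementary) route, with every constant explicit.

v1.0.1 (2026-08-19, docstring-only DOCFIX N1 of GAPS C-lit1g7-4, XREAD by beta-lit1-g7 00:54:47Z): the Dimock locator above read «App. C» in v1; the appendix of arXiv:1108.1335v2 containing Lemma 31 and Lemma 33 («Estimate on G_k(□̃)») is App. D (e-print TeX ll. 3584–3894, read by lit1-g7); no declaration changed.

THE ROUTE (all inputs KERNEL in the tree).  (i) `Beta/TorusG0Decay.setDecay_torus` (pv23-g3; Combes–Thomas at the
`η`-free smallness `2dδ² + a(e^δ−1) ≤ min(2,a)/2`) + Cauchy–Schwarz: the `ℓ¹`-mass of `G₀g` on any set of `≤ (n+1)^d`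
sites at block-distance `R` from `supp g` is `≤ (n+1)^d (2/min(2,a)) e^{−δR}` (§2 `sum_abs_G0_le`).  (ii) The equation
`H G₀ = 1` (pv23-g3 `TorusG0Kernel.torusOp_mulVec_G0`) read pointwise (`TorusG0Decay.torusOp_mulVec`): `Δ₁(G₀g)(y) = ((a/(n+1)^d)Σ_{B(y)}G₀g
− g(y))/(n+1)²` (§2 `lapT_G0`), whence `|Δ₁(G₀g)| ≤ (a(2/min(2,a))e^{−δR′} + |g|)(n+1)⁻²` (§2 `abs_lapT_G0_le`) — the
unit-lattice Laplacian of `G₀g` is `O(η²)`, exponentially small away from the source.  (iii) The periodic lift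
`z ↦ x + (z mod N)` of `ℤ^d` onto the torus (§1; injective on cubes of radius `< N_μ/2`, an isometry for `ldist` up to
the radius, intertwining `latticeLaplacianZd` with `Δ₁`) carries `G₀g` to a function on `ℤ^d` to which the discrete
interior estimate `Beta/PoissonInterior.interior_estimate` (this unit, (B1); pure `ℤ^d`, `d ≥ 3`, lit1's lattice Green
function) applies on the cube of radius `3m`, `m = ⌊(n+1)/8⌋`: `|u(x)| ≤ C(m²A + B/m^d)`, `|∇u(x)| ≤ C(mA + B/m^{d+1})`
with `A = O((n+1)⁻²)e^{−δR}` from (ii) and `B = O((n+1)^d)e^{−δR}` from (i); since `m ≍ n+1` both legs come out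
mesh-uniform, the gradient with one extra factor `(n+1)⁻¹ = η`.  `n + 1 ≤ 7` is the crude pointwise bound.
Relation to pv23-g3's `Beta/TorusG0GradDecay` / `Beta/TorusG0DivDecay` (imported for the `edist` lemmas): those give
`η`-uniform `L²` SET-TO-SET decay of `∇^ηG₀`, `G₀∇^{η*}` (energy form of Combes–Thomas); the present legs are the
POINTWISE (sup) statements, which `L²` bounds alone cannot give without losing powers of the block volume `(n+1)^d` —
the interior estimate is what removes that loss.

THE SETTING (objects of the imports).  The fine torus `Tor (fine (n+1) M)` (periods `(n+1)M_μ ≥ 3`, `n+1` sites per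
block and direction, mesh `η = 1/(n+1)`), blocks `B(b) = {k : blockOf k = b}`, `b ∈ Tor M`; `G0 n M a = (torusOp n M a)⁻¹`;
`ldist` = the sup torus distance in lattice units, `edist = ldist/(n+1)` (block units); a source `g` supported in `T`
with `|g| ≤ 1` and `Σ g² ≤ (n+1)^d` (e.g. `g = 1_{B(b)}`, `T = B(b)`); `R ≤ edist(x,t)` for all `t ∈ T`.

WHAT IS PROVED (zero `sorry`; constants explicit; uniform in the mesh `n`, the volume `M`, and locally uniformly in `a`
through the displayed factor `(2+a)/min(2,a)`):
 §1 `liftPt`/`lift`/`lapT`: the periodic lift, `lap_lift` (`Δ_{ℤ^d}(lift u) = lift(Δ₁u)`), `ldist_liftPt_le`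
    (`ldist(x, x+z) ≤ ‖z‖_∞`), `liftPt_injOn` (injective on `cube 0 R` when `2R+1 ≤ N_μ`).
 §2 `sum_abs_G0_le` (i), `lapT_G0` and `abs_lapT_G0_le` (ii), `abs_G0_le` (pointwise Combes–Thomas), `card_cube`.
 §3 `transport_legs` (`d ≥ 3`): `∃ K = K(d) ≥ 0` such that for all `n, M, a > 0, δ ∈ [0,1]` with the smallness, all
    such `g, T, x, R`:  `|(G₀g)(x)| ≤ K·(2+a)/min(2,a)·e^{−δR}`  and, for every `μ`,
    `|(G₀g)(x+e_μ) − (G₀g)(x)| ≤ K·(2+a)/min(2,a)·(n+1)⁻¹·e^{−δR}`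
    (`K = 2C e²(1+16^{d+1}) + 2e·7^{d+1}`, `C` the interior-estimate constant).
 §4 `block_legs`: the same for the block indicator `g = 1_{B(b)}` at an5-g4's standard rate
    `δ = deltaStd d a = min(2,a)/(4(d+a+1)) > 0` (its smallness is `EffectiveKernel.deltaStd_small`); non-vacuity at
    `d = 4` (`deltaStd 4 1 = 1/24`).

HONEST SCOPE.  (i) Scalar, one component, `A = 0`, periodic b.c. (the torus is B4's «rectangular parallelepiped»
case with no boundary): the covariant `U(A(Γ_{x,x′}))`-twisted statements, the Hölder leg (1.9), the `Ω`-localised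
versions and (1.11)–(1.12) are NOT touched.  (ii) ONE derivative per leg: the value leg and the first-difference leg;
a same-leg second difference (Dimock's `δ_α ∂ G_k`) would need third differences of the lattice Green function, which
lit1's `LatticeModels` does not provide — not attempted (road (β) of G-sb12-4 consumes one derivative per leg, GAPS
C-an1-18 (d)).  (iii) `d ≥ 3` (lit1's Green-function asymptotics); `d = 4` is the case of interest.  (iv) Distances
are to the support: for a general bounded `f` the legs follow by linearity from `block_legs` and the block profile sum
(`EffectiveKernel.sum_exp_ldist_le`) — not written here.  (v) The rate is any Combes–Thomas-admissible `δ ≤ 1` per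
BLOCK step (`edist`), e.g. `deltaStd`; no optimality is claimed, and `K(d)` is far from sharp.
Cell records: GAPS.md C-pv23g4-3, node G-sb12-4-S2-KERNELS (B2) (journal CLAIM 2026-08-19; (A) `Beta/FluctuationCovariance`
c47756badf6d, (B1) `Beta/PoissonInterior` bb9814b68c45).  Unit `b2b-balaban-pv23-g4` (SURGE NODE PROVER #23, gen 4);
staged byte-identically under `HOME/lean/BalabanYm4/`.  Value = kernel certificate of a printed-claimed per-step input
(B4 (1.10), two legs, `A = 0`, torus) for the toy operator, NOT summit progress, NOT the continuum limit.
-/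

open Finset Matrix

namespace Literature.MathematicalPhysics.QuantumFieldTheory.Balaban1983to89.Beta.TransportLeg

noncomputable section

open Literature.Probability.LatticeModels (latticeLaplacianZd latticeLaplacianZd_def)
open B5Prop11Plancherel (Tor fine unitVec)
open B4TorusKernel.MultiPeriod (circAbs circAbs_le_abs circAbs_nonneg)
open TorusG0Decay (torusOp torusOp_mulVec ldist edist ldist_self ldist_symm ldist_triangle ldist_le_of_forall
  ldist_le_of_same_block circAbs_congr circAbs_val_add setDecay_torus one_le card_block sum_blockInd_sq)
open TorusG0Kernel (G0 torusOp_mulVec_G0)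
open EffectiveKernel (deltaStd deltaStd_pos deltaStd_le_one deltaStd_small)
open TorusG0DivDecay (edist_triangle edist_step_le)
open PoissonInterior (cube mem_cube mem_cube_zero_iff supNorm natAbs_le_supNorm natAbs_le_iff_abs_le supNorm_le_iff
  interior_estimate)

/-! ## §1 The periodic lift `ℤ^d → Tor N` based at a point -/

section Lift

variable {d : ℕ} (N : Fin d → ℕ)

/-- the periodic parametrisation of the torus by `ℤ^d` based at `x`: `z ↦ x + (z mod N)`. [folklore] -/
def liftPt (x : Tor N) (z : Fin d → ℤ) : Tor N := fun μ => x μ + ((z μ : ℤ) : ZMod (N μ))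

/-- `liftPt x 0 = x`. [folklore] -/
theorem liftPt_zero (x : Tor N) : liftPt N x 0 = x := by
  funext μ; simp [liftPt]

/-- additivity of the parametrisation. [folklore] -/
theorem liftPt_add (x : Tor N) (z z' : Fin d → ℤ) : liftPt N x (z + z') = liftPt N (liftPt N x z) z' := by
  funext μ; simp [liftPt, add_assoc]

/-- a unit step of `ℤ^d` is a unit step of the torus. [folklore] -/
theorem liftPt_single (x : Tor N) (μ : Fin d) : liftPt N x (Pi.single μ 1) = x + unitVec N μ := by
  funext ν
  by_cases h : ν = μ
  · subst h; simp [liftPt, unitVec]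
  · simp [liftPt, unitVec, h]

/-- `liftPt x (z + e_μ) = liftPt x z + e_μ`. [folklore] -/
theorem liftPt_add_single (x : Tor N) (z : Fin d → ℤ) (μ : Fin d) :
    liftPt N x (z + Pi.single μ 1) = liftPt N x z + unitVec N μ := by
  rw [liftPt_add, liftPt_single]

/-- `liftPt x (z − e_μ) = liftPt x z − e_μ`. [folklore] -/
theorem liftPt_sub_single (x : Tor N) (z : Fin d → ℤ) (μ : Fin d) :
    liftPt N x (z - Pi.single μ 1) = liftPt N x z - unitVec N μ := by
  rw [eq_sub_iff_add_eq, ← liftPt_add_single, sub_add_cancel]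

/-- the periodic lift of a torus function, based at `x`: `(lift u x)(z) = u(x + z mod N)`. [folklore] -/
def lift (u : Tor N → ℝ) (x : Tor N) : (Fin d → ℤ) → ℝ := fun z => u (liftPt N x z)

/-- `lift u x 0 = u x`. [folklore] -/
theorem lift_zero (u : Tor N → ℝ) (x : Tor N) : lift N u x 0 = u x := by
  simp only [lift, liftPt_zero]

/-- `lift u x e_μ = u (x + e_μ)`. [folklore] -/
theorem lift_single (u : Tor N → ℝ) (x : Tor N) (μ : Fin d) : lift N u x (Pi.single μ 1) = u (x + unitVec N μ) := by
  simp only [lift, liftPt_single]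

/-- the unit-lattice Laplacian on the torus: `Δ₁u(y) = Σ_μ (u(y+e_μ) + u(y−e_μ)) − 2d·u(y)`. [folklore] -/
def lapT (u : Tor N → ℝ) (y : Tor N) : ℝ := ∑ μ : Fin d, (u (y + unitVec N μ) + u (y - unitVec N μ)) - 2 * d * u y

/-- the `ℤ^d` Laplacian of the lift is the lift of the torus Laplacian. [folklore] -/
theorem lap_lift (u : Tor N → ℝ) (x : Tor N) (z : Fin d → ℤ) :
    latticeLaplacianZd (lift N u x) z = lapT N u (liftPt N x z) := by
  simp only [latticeLaplacianZd_def, lift, lapT, liftPt_add_single, liftPt_sub_single]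

/-- the base point and its translate by `z` are at torus distance `≤ ‖z‖_∞`. [folklore] -/
theorem ldist_liftPt_le [∀ μ, NeZero (N μ)] (x : Tor N) (z : Fin d → ℤ) : ldist N x (liftPt N x z) ≤ supNorm z := by
  rw [ldist_symm]
  refine ldist_le_of_forall N fun i => ?_
  show circAbs (N i) (((x i + ((z i : ℤ) : ZMod (N i))).val : ℤ) - ((x i).val : ℤ)) ≤ _
  rw [circAbs_val_add]
  have hc : circAbs (N i) (((((z i : ℤ) : ZMod (N i))).val : ℕ) : ℤ) = circAbs (N i) (z i) := by
    apply circAbs_congr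
    rw [Int.cast_natCast, ZMod.natCast_zmod_val]
  rw [hc]
  calc circAbs (N i) (z i) ≤ |z i| := circAbs_le_abs (one_le N i) _
    _ ≤ (supNorm z : ℤ) := (natAbs_le_iff_abs_le _ _).mp (natAbs_le_supNorm z i)

/-- the parametrisation is injective on a cube of radius `R` as soon as every period is `≥ 2R + 1`. [folklore] -/
theorem liftPt_injOn (x : Tor N) {R : ℕ} (hR : ∀ μ, 2 * R + 1 ≤ N μ) :
    Set.InjOn (liftPt N x) (cube (0 : Fin d → ℤ) R : Set (Fin d → ℤ)) := by
  intro z hz z' hz' h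
  rw [Finset.mem_coe, mem_cube_zero_iff] at hz hz'
  funext μ
  have hμ := congrFun h μ
  simp only [liftPt, add_right_inj] at hμ
  rw [ZMod.intCast_eq_intCast_iff_dvd_sub] at hμ
  have h1 : (z μ).natAbs ≤ R := (natAbs_le_supNorm z μ).trans hz
  have h2 : (z' μ).natAbs ≤ R := (natAbs_le_supNorm z' μ).trans hz'
  have h3 : (z' μ - z μ).natAbs < ((N μ : ℕ) : ℤ).natAbs := by
    rw [Int.natAbs_natCast]
    have := Int.natAbs_sub_le (z' μ) (z μ)
    have := hR μ
    omega
  have := Int.eq_zero_of_dvd_of_natAbs_lt_natAbs hμ h3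
  omega

end Lift

/-! ## §2 Consequences of the Combes–Thomas bound on the fine torus -/

section Torus

variable {d : ℕ} (n : ℕ) (M : Fin d → ℕ) [hM : ∀ μ, NeZero (M μ)]

/-- two sites of one block are at `edist ≤ 1`. [folklore] -/
theorem edist_same_block_le {y k : Tor (fine (n + 1) M)}
    (h : B5Blocks16.blockOf (n + 1) M y = B5Blocks16.blockOf (n + 1) M k) : edist n M y k ≤ 1 := by
  simp only [TorusG0Decay.edist]
  have hn : (0 : ℝ) < (n : ℝ) + 1 := by positivity
  calc 1 / ((n : ℝ) + 1) * ldist (fine (n + 1) M) y k ≤ 1 / ((n : ℝ) + 1) * n :=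
        mul_le_mul_of_nonneg_left (ldist_le_of_same_block n M h) (by positivity)
    _ ≤ 1 := by rw [div_mul_eq_mul_div, one_mul, div_le_one hn]; linarith

/-- the lifted point `x + z` is at `edist ≤ ‖z‖_∞/(n+1)` from `x`. [folklore] -/
theorem edist_liftPt_le (x : Tor (fine (n + 1) M)) (z : Fin d → ℤ) :
    edist n M x (liftPt (fine (n + 1) M) x z) ≤ (supNorm z : ℝ) / ((n : ℝ) + 1) := by
  simp only [TorusG0Decay.edist]
  calc 1 / ((n : ℝ) + 1) * ldist (fine (n + 1) M) x (liftPt (fine (n + 1) M) x z) ≤ 1 / ((n : ℝ) + 1) * (supNorm z : ℝ) :=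
        mul_le_mul_of_nonneg_left (ldist_liftPt_le _ x z) (by positivity)
    _ = (supNorm z : ℝ) / ((n : ℝ) + 1) := by ring

/-- **`ℓ¹` form of the Combes–Thomas bound**: for a source `g` with `Σ g² ≤ (n+1)^d` supported in `T`, and a
set `S` of at most `(n+1)^d` sites all at `edist ≥ R` from `T`:
`Σ_{x∈S} |(G₀ g)(x)| ≤ (n+1)^d · (2/min(2,a)) · e^{−δR}`. [folklore] -/
theorem sum_abs_G0_le (h3 : ∀ μ, 3 ≤ fine (n + 1) M μ) {a δ : ℝ} (ha : 0 < a) (hδ0 : 0 ≤ δ) (hδ1 : δ ≤ 1)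
    (hsmall : 2 * (d : ℝ) * δ ^ 2 + a * (Real.exp δ - 1) ≤ min 2 a / 2)
    (S T : Finset (Tor (fine (n + 1) M))) (hT : T.Nonempty) (hS : (S.card : ℝ) ≤ ((n : ℝ) + 1) ^ d)
    (R : ℝ) (hR : ∀ x ∈ S, ∀ t ∈ T, R ≤ edist n M x t)
    (g : Tor (fine (n + 1) M) → ℝ) (hg : ∀ x, x ∉ T → g x = 0) (hg2 : ∑ x, g x ^ 2 ≤ ((n : ℝ) + 1) ^ d) :
    ∑ x ∈ S, |(G0 n M a).mulVec g x| ≤ ((n : ℝ) + 1) ^ d * (2 / min 2 a) * Real.exp (-(δ * R)) := by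
  have hσ : 0 < min 2 a := lt_min two_pos ha
  set v := (G0 n M a).mulVec g with hv
  have hdec := setDecay_torus n M h3 ha hδ0 hδ1 hsmall S T hT R hR g v hg (torusOp_mulVec_G0 n M h3 ha g)
  have hCS : (∑ x ∈ S, |v x|) ^ 2 ≤ (S.card : ℝ) * ∑ x ∈ S, v x ^ 2 := by
    have h := Finset.sum_mul_sq_le_sq_mul_sq S (fun x => |v x|) (fun _ => (1 : ℝ))
    simp only [mul_one, one_pow, Finset.sum_const, nsmul_eq_mul, sq_abs] at h
    linarith [h]
  have hsq : (∑ x ∈ S, |v x|) ^ 2 ≤ (((n : ℝ) + 1) ^ d * (2 / min 2 a) * Real.exp (-(δ * R))) ^ 2 := by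
    calc (∑ x ∈ S, |v x|) ^ 2 ≤ (S.card : ℝ) * ∑ x ∈ S, v x ^ 2 := hCS
      _ ≤ ((n : ℝ) + 1) ^ d * ((2 / min 2 a) ^ 2 * Real.exp (-(2 * (δ * R))) * ((n : ℝ) + 1) ^ d) := by
          apply mul_le_mul hS (hdec.trans _) (Finset.sum_nonneg fun x _ => sq_nonneg _) (by positivity)
          exact mul_le_mul_of_nonneg_left hg2 (by positivity)
      _ = (((n : ℝ) + 1) ^ d * (2 / min 2 a) * Real.exp (-(δ * R))) ^ 2 := by
          have he : Real.exp (-(2 * (δ * R))) = Real.exp (-(δ * R)) ^ 2 := by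
            rw [sq, ← Real.exp_add]; congr 1; ring
          rw [he]; ring
  have hpos : 0 ≤ ((n : ℝ) + 1) ^ d * (2 / min 2 a) * Real.exp (-(δ * R)) := by positivity
  exact (abs_le_of_sq_le_sq' hsq hpos).2

/-- the number of sites of a cube of radius `R` in `ℤ^d` is `(2R+1)^d`. [folklore] -/
theorem card_cube (c : Fin d → ℤ) (R : ℕ) : (cube c R).card = (2 * R + 1) ^ d := by
  unfold cube
  rw [Fintype.card_piFinset]
  have h : ∀ i, (Finset.Icc (c i - R) (c i + R)).card = 2 * R + 1 := fun i => by
    rw [Int.card_Icc, show c i + (R : ℤ) + 1 - (c i - R) = ((2 * R + 1 : ℕ) : ℤ) by push_cast; ring, Int.toNat_natCast]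
  simp [h, Finset.prod_const]

/-- **the unit-lattice Poisson equation of `v = G₀ g`**: `Δ₁v(y) = ((a/(n+1)^d)·Σ_{B(y)} v − g(y))/(n+1)²`
(`H = (n+1)²(−Δ₁) + a·(block means)`, `H G₀ = 1`). [folklore] -/
theorem lapT_G0 (h3 : ∀ μ, 3 ≤ fine (n + 1) M μ) {a : ℝ} (ha : 0 < a) (g : Tor (fine (n + 1) M) → ℝ)
    (y : Tor (fine (n + 1) M)) :
    lapT (fine (n + 1) M) ((G0 n M a).mulVec g) y =
      (a / ((n : ℝ) + 1) ^ d *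
          ∑ k ∈ univ.filter (fun k => B5Blocks16.blockOf (n + 1) M k = B5Blocks16.blockOf (n + 1) M y),
            (G0 n M a).mulVec g k - g y) / ((n : ℝ) + 1) ^ 2 := by
  have h := torusOp_mulVec n M h3 a ((G0 n M a).mulVec g) y
  rw [torusOp_mulVec_G0 n M h3 ha g] at h
  have hn : (0 : ℝ) < ((n : ℝ) + 1) ^ 2 := by positivity
  rw [eq_div_iff hn.ne']
  have hsum : ∑ μ : Fin d, (2 * (G0 n M a).mulVec g y - (G0 n M a).mulVec g (y + unitVec _ μ)
      - (G0 n M a).mulVec g (y - unitVec _ μ)) = 2 * d * (G0 n M a).mulVec g y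
      - ∑ μ : Fin d, ((G0 n M a).mulVec g (y + unitVec _ μ) + (G0 n M a).mulVec g (y - unitVec _ μ)) := by
    rw [Finset.sum_sub_distrib, Finset.sum_sub_distrib, Finset.sum_const, card_univ, Fintype.card_fin,
      Finset.sum_add_distrib]
    simp only [nsmul_eq_mul]; ring
  unfold lapT
  rw [hsum] at h
  linarith [h]

/-- **pointwise bound on `Δ₁(G₀ g)`**: if every site of the block of `y` is at `edist ≥ R′` from the support `T` of
`g` (`|g| ≤ 1`, `Σ g² ≤ (n+1)^d`), then `|Δ₁(G₀g)(y)| ≤ (a·(2/min(2,a))·e^{−δR′} + |g(y)|)/(n+1)²`. [folklore] -/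
theorem abs_lapT_G0_le (h3 : ∀ μ, 3 ≤ fine (n + 1) M μ) {a δ : ℝ} (ha : 0 < a) (hδ0 : 0 ≤ δ) (hδ1 : δ ≤ 1)
    (hsmall : 2 * (d : ℝ) * δ ^ 2 + a * (Real.exp δ - 1) ≤ min 2 a / 2)
    (T : Finset (Tor (fine (n + 1) M))) (hT : T.Nonempty)
    (g : Tor (fine (n + 1) M) → ℝ) (hg : ∀ x, x ∉ T → g x = 0) (hg2 : ∑ x, g x ^ 2 ≤ ((n : ℝ) + 1) ^ d)
    (y : Tor (fine (n + 1) M)) (R' : ℝ)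
    (hR' : ∀ k, B5Blocks16.blockOf (n + 1) M k = B5Blocks16.blockOf (n + 1) M y → ∀ t ∈ T, R' ≤ edist n M k t) :
    |lapT (fine (n + 1) M) ((G0 n M a).mulVec g) y| ≤
      (a * (2 / min 2 a) * Real.exp (-(δ * R')) + |g y|) / ((n : ℝ) + 1) ^ 2 := by
  have hn2 : (0 : ℝ) < ((n : ℝ) + 1) ^ 2 := by positivity
  have hnd : (0 : ℝ) < ((n : ℝ) + 1) ^ d := by positivity
  rw [lapT_G0 n M h3 ha g y, abs_div, abs_of_pos hn2]
  apply div_le_div_of_nonneg_right _ hn2.le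
  have hblock := sum_abs_G0_le n M h3 ha hδ0 hδ1 hsmall
    (univ.filter (fun k => B5Blocks16.blockOf (n + 1) M k = B5Blocks16.blockOf (n + 1) M y)) T hT
    (by rw [card_block]; push_cast; exact le_rfl) R' (fun k hk t ht => hR' k (mem_filter.mp hk).2 t ht) g hg hg2
  calc |a / ((n : ℝ) + 1) ^ d * ∑ k ∈ univ.filter
            (fun k => B5Blocks16.blockOf (n + 1) M k = B5Blocks16.blockOf (n + 1) M y), (G0 n M a).mulVec g k - g y|
      ≤ |a / ((n : ℝ) + 1) ^ d * ∑ k ∈ univ.filter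
            (fun k => B5Blocks16.blockOf (n + 1) M k = B5Blocks16.blockOf (n + 1) M y), (G0 n M a).mulVec g k|
          + |g y| := abs_sub _ _
    _ ≤ a * (2 / min 2 a) * Real.exp (-(δ * R')) + |g y| := by
        gcongr
        rw [abs_mul, abs_of_pos (by positivity : (0 : ℝ) < a / ((n : ℝ) + 1) ^ d)]
        calc a / ((n : ℝ) + 1) ^ d * |∑ k ∈ univ.filter
                (fun k => B5Blocks16.blockOf (n + 1) M k = B5Blocks16.blockOf (n + 1) M y), (G0 n M a).mulVec g k|
            ≤ a / ((n : ℝ) + 1) ^ d * ∑ k ∈ univ.filter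
                (fun k => B5Blocks16.blockOf (n + 1) M k = B5Blocks16.blockOf (n + 1) M y), |(G0 n M a).mulVec g k| :=
              mul_le_mul_of_nonneg_left (abs_sum_le_sum_abs _ _) (by positivity)
          _ ≤ a / ((n : ℝ) + 1) ^ d * (((n : ℝ) + 1) ^ d * (2 / min 2 a) * Real.exp (-(δ * R'))) :=
              mul_le_mul_of_nonneg_left hblock (by positivity)
          _ = a * (2 / min 2 a) * Real.exp (-(δ * R')) := by
              field_simp

/-- **pointwise Combes–Thomas bound**: `|(G₀ g)(y)| ≤ (n+1)^d·(2/min(2,a))·e^{−δR′}` for `y` at `edist ≥ R′` from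
the support of `g` (the crude bound used only for bounded `n`). [folklore] -/
theorem abs_G0_le (h3 : ∀ μ, 3 ≤ fine (n + 1) M μ) {a δ : ℝ} (ha : 0 < a) (hδ0 : 0 ≤ δ) (hδ1 : δ ≤ 1)
    (hsmall : 2 * (d : ℝ) * δ ^ 2 + a * (Real.exp δ - 1) ≤ min 2 a / 2)
    (T : Finset (Tor (fine (n + 1) M))) (hT : T.Nonempty)
    (g : Tor (fine (n + 1) M) → ℝ) (hg : ∀ x, x ∉ T → g x = 0) (hg2 : ∑ x, g x ^ 2 ≤ ((n : ℝ) + 1) ^ d)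
    (y : Tor (fine (n + 1) M)) (R' : ℝ) (hR' : ∀ t ∈ T, R' ≤ edist n M y t) :
    |(G0 n M a).mulVec g y| ≤ ((n : ℝ) + 1) ^ d * (2 / min 2 a) * Real.exp (-(δ * R')) := by
  have h := sum_abs_G0_le n M h3 ha hδ0 hδ1 hsmall {y} T hT
    (by rw [card_singleton]; push_cast; exact one_le_pow₀ (by linarith [(Nat.cast_nonneg n : (0 : ℝ) ≤ n)]))
    R' (fun x hx t ht => by rw [mem_singleton] at hx; rw [hx]; exact hR' t ht) g hg hg2
  simpa using h

end Torus

/-! ## §3 The transport legs: sup decay and `(n+1)⁻¹`-gradient decay of `G₀ g` -/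

section Main

variable {d : ℕ}

set_option maxHeartbeats 400000 in
/-- **The two transport-leg estimates** (operator level, one derivative per leg).  There is `K = K(d)` such that
for every fine torus (`n+1 ≥ 1` sites per block and direction, all periods `≥ 3`), every `a > 0`, every
Combes–Thomas rate `δ ∈ [0,1]` with `2dδ² + a(e^δ − 1) ≤ min(2,a)/2`, every source `g` supported in a set `T`
with `|g| ≤ 1` and `Σ g² ≤ (n+1)^d` (e.g. the indicator of one block), every site `x` and every `R` with
`R ≤ edist(x,t)` for all `t ∈ T` (`edist = ldist/(n+1)`, the torus sup-distance in block units):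
`|(G₀ g)(x)| ≤ K·(2+a)/min(2,a)·e^{−δR}` and `|(G₀ g)(x+e_μ) − (G₀ g)(x)| ≤ K·(2+a)/min(2,a)·(n+1)⁻¹·e^{−δR}`,
`G₀ = G0 n M a = ((n+1)²(−Δ₁) + a·Q*Q)⁻¹`.  Proof: Combes–Thomas set decay (TorusG0Decay/TorusG0Kernel) gives
the block-`ℓ¹` masses and, through the equation `H G₀ = 1`, a sup bound on `Δ₁(G₀ g)`; the interior estimate of
`PoissonInterior` on the periodic lift over a cube of radius `3⌊(n+1)/8⌋` converts these into the two legs;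
`n + 1 ≤ 7` is the crude pointwise bound. [folklore] -/
theorem transport_legs (hd : 3 ≤ d) : ∃ K : ℝ, 0 ≤ K ∧
    ∀ (n : ℕ) (M : Fin d → ℕ) [∀ μ, NeZero (M μ)], (∀ μ, 3 ≤ fine (n + 1) M μ) →
    ∀ (a δ : ℝ), 0 < a → 0 ≤ δ → δ ≤ 1 → 2 * (d : ℝ) * δ ^ 2 + a * (Real.exp δ - 1) ≤ min 2 a / 2 →
    ∀ (T : Finset (Tor (fine (n + 1) M))) (g : Tor (fine (n + 1) M) → ℝ),
      (∀ x, x ∉ T → g x = 0) → (∀ x, |g x| ≤ 1) → (∑ x, g x ^ 2 ≤ ((n : ℝ) + 1) ^ d) →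
    ∀ (x : Tor (fine (n + 1) M)) (R : ℝ), (∀ t ∈ T, R ≤ edist n M x t) →
      |(G0 n M a).mulVec g x| ≤ K * ((2 + a) / min 2 a) * Real.exp (-(δ * R)) ∧
      ∀ μ : Fin d, |(G0 n M a).mulVec g (x + unitVec (fine (n + 1) M) μ) - (G0 n M a).mulVec g x|
        ≤ K * ((2 + a) / min 2 a) / ((n : ℝ) + 1) * Real.exp (-(δ * R)) := by
  obtain ⟨C, hC0, hC⟩ := interior_estimate (d := d) hd
  refine ⟨2 * C * Real.exp 2 * (1 + 16 ^ (d + 1)) + 2 * Real.exp 1 * 7 ^ (d + 1), by positivity, ?_⟩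
  intro n M _ h3 a δ ha hδ0 hδ1 hsmall T g hg hg1 hg2 x R hR
  set K : ℝ := 2 * C * Real.exp 2 * (1 + 16 ^ (d + 1)) + 2 * Real.exp 1 * 7 ^ (d + 1) with hK
  have hσ : 0 < min 2 a := lt_min two_pos ha
  have hσ2 : min 2 a ≤ 2 := min_le_left _ _
  set q : ℝ := 2 / min 2 a with hq
  have hq0 : 0 < q := by positivity
  have hq1 : 1 ≤ q := by rw [hq, le_div_iff₀ hσ]; linarith
  have hn0 : (0 : ℝ) < (n : ℝ) + 1 := by positivity
  have hX0 : 0 < Real.exp (-(δ * R)) := Real.exp_pos _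
  have hfac : 0 ≤ (2 + a) / min 2 a := by positivity
  have hKq : ∀ L : ℝ, L * ((2 + a) * q * Real.exp (-(δ * R))) = 2 * L * ((2 + a) / min 2 a) * Real.exp (-(δ * R)) := by
    intro L; rw [hq]; ring
  -- the degenerate case `T = ∅`: `g = 0`
  rcases T.eq_empty_or_nonempty with hT | hT
  · have hg0 : g = 0 := funext fun y => hg y (by rw [hT]; exact Finset.notMem_empty y)
    rw [hg0, Matrix.mulVec_zero]
    refine ⟨by simp; positivity, fun μ => by simp; positivity⟩
  set v := (G0 n M a).mulVec g with hv
  -- pointwise bounds at `x` and `x + e_μ`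
  have hpt : ∀ (y : Tor (fine (n + 1) M)) (R' : ℝ), (∀ t ∈ T, R' ≤ edist n M y t) →
      |v y| ≤ ((n : ℝ) + 1) ^ d * q * Real.exp (-(δ * R')) :=
    fun y R' h => abs_G0_le n M h3 ha hδ0 hδ1 hsmall T hT g hg hg2 y R' h
  have hper2 : ∀ μ, 2 ≤ fine (n + 1) M μ := fun μ => le_trans (by norm_num) (h3 μ)
  have hRstep : ∀ μ, ∀ t ∈ T, R - 1 ≤ edist n M (x + unitVec (fine (n + 1) M) μ) t := by
    intro μ t ht
    have h1 := edist_triangle n M x (x + unitVec (fine (n + 1) M) μ) t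
    have h2 := edist_step_le n M hper2 x μ
    have h3' : 1 / ((n : ℝ) + 1) ≤ 1 := by
      rw [div_le_one hn0]; linarith [(Nat.cast_nonneg n : (0 : ℝ) ≤ n)]
    linarith [hR t ht]
  have hexp1 : Real.exp (-(δ * (R - 1))) ≤ Real.exp 1 * Real.exp (-(δ * R)) := by
    rw [← Real.exp_add]; exact Real.exp_le_exp.mpr (by nlinarith)
  have he1 : 1 ≤ Real.exp 1 := Real.one_le_exp zero_le_one
  by_cases hn7 : n + 1 ≤ 7
  · -- bounded `n`: crude pointwise bounds
    have hn7' : (n : ℝ) + 1 ≤ 7 := by exact_mod_cast hn7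
    have hnd : ((n : ℝ) + 1) ^ d ≤ 7 ^ d := pow_le_pow_left₀ hn0.le hn7' d
    have h7 : (7 : ℝ) ^ d ≤ 7 ^ (d + 1) := pow_le_pow_right₀ (by norm_num) (by omega)
    have hvx : |v x| ≤ 7 ^ d * q * Real.exp (-(δ * R)) :=
      (hpt x R hR).trans (by gcongr)
    constructor
    · calc |v x| ≤ 7 ^ d * q * Real.exp (-(δ * R)) := hvx
        _ ≤ (Real.exp 1 * 7 ^ (d + 1)) * ((2 + a) * q * Real.exp (-(δ * R))) := by
            have h77 : (7 : ℝ) ^ d ≤ Real.exp 1 * 7 ^ (d + 1) * (2 + a) :=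
              calc (7 : ℝ) ^ d ≤ 7 ^ (d + 1) := h7
                _ = 1 * 7 ^ (d + 1) * 1 := by ring
                _ ≤ Real.exp 1 * 7 ^ (d + 1) * (2 + a) := by
                    apply mul_le_mul _ (by linarith) zero_le_one (by positivity)
                    exact mul_le_mul_of_nonneg_right he1 (by positivity)
            calc (7 : ℝ) ^ d * q * Real.exp (-(δ * R)) = 7 ^ d * (q * Real.exp (-(δ * R))) := by ring
              _ ≤ Real.exp 1 * 7 ^ (d + 1) * (2 + a) * (q * Real.exp (-(δ * R))) :=
                  mul_le_mul_of_nonneg_right h77 (by positivity)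
              _ = _ := by ring
        _ = 2 * (Real.exp 1 * 7 ^ (d + 1)) * ((2 + a) / min 2 a) * Real.exp (-(δ * R)) := hKq _
        _ ≤ K * ((2 + a) / min 2 a) * Real.exp (-(δ * R)) := by
            apply mul_le_mul_of_nonneg_right _ hX0.le
            apply mul_le_mul_of_nonneg_right _ hfac
            have : 0 ≤ 2 * C * Real.exp 2 * (1 + 16 ^ (d + 1)) := by positivity
            rw [hK]; linarith
    · intro μ
      have hvμ : |v (x + unitVec (fine (n + 1) M) μ)| ≤ 7 ^ d * q * (Real.exp 1 * Real.exp (-(δ * R))) :=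
        (hpt _ (R - 1) (hRstep μ)).trans (by gcongr)
      have hsum : |v (x + unitVec (fine (n + 1) M) μ) - v x| ≤ 2 * 7 ^ d * q * Real.exp 1 * Real.exp (-(δ * R)) := by
        refine (abs_sub _ _).trans ?_
        have : 7 ^ d * q * Real.exp (-(δ * R)) ≤ 7 ^ d * q * (Real.exp 1 * Real.exp (-(δ * R))) :=
          mul_le_mul_of_nonneg_left (le_mul_of_one_le_left hX0.le he1) (by positivity)
        linarith
      calc |v (x + unitVec (fine (n + 1) M) μ) - v x| ≤ 2 * 7 ^ d * q * Real.exp 1 * Real.exp (-(δ * R)) := hsum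
        _ ≤ (Real.exp 1 * 7 ^ (d + 1)) * ((2 + a) * q * Real.exp (-(δ * R))) / ((n : ℝ) + 1) := by
            rw [le_div_iff₀ hn0]
            calc 2 * 7 ^ d * q * Real.exp 1 * Real.exp (-(δ * R)) * ((n : ℝ) + 1)
                ≤ 2 * 7 ^ d * q * Real.exp 1 * Real.exp (-(δ * R)) * 7 := mul_le_mul_of_nonneg_left hn7' (by positivity)
              _ = 2 * (7 ^ (d + 1) * q * Real.exp 1 * Real.exp (-(δ * R))) := by ring
              _ ≤ (2 + a) * (7 ^ (d + 1) * q * Real.exp 1 * Real.exp (-(δ * R))) :=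
                  mul_le_mul_of_nonneg_right (by linarith) (by positivity)
              _ = _ := by ring
        _ = 2 * (Real.exp 1 * 7 ^ (d + 1)) * ((2 + a) / min 2 a) / ((n : ℝ) + 1) * Real.exp (-(δ * R)) := by
            rw [hq]; ring
        _ ≤ K * ((2 + a) / min 2 a) / ((n : ℝ) + 1) * Real.exp (-(δ * R)) := by
            apply mul_le_mul_of_nonneg_right _ hX0.le
            apply div_le_div_of_nonneg_right _ hn0.le
            apply mul_le_mul_of_nonneg_right _ hfac
            have : 0 ≤ 2 * C * Real.exp 2 * (1 + 16 ^ (d + 1)) := by positivity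
            rw [hK]; linarith
  · -- `n + 1 ≥ 8`: the interior estimate on the periodic lift over the cube of radius `3m`, `m = ⌊(n+1)/8⌋`
    rw [not_le] at hn7
    set m : ℕ := (n + 1) / 8 with hm
    have hm1 : 1 ≤ m := by omega
    have h8m : 8 * m ≤ n + 1 := by omega
    have h16m : n + 1 ≤ 16 * m := by omega
    have hmR : (m : ℝ) ≤ (n : ℝ) + 1 := by exact_mod_cast (show m ≤ n + 1 by omega)
    have h16R : (n : ℝ) + 1 ≤ 16 * m := by exact_mod_cast h16m
    have hm0 : (0 : ℝ) < m := by exact_mod_cast hm1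
    set E : ℝ := Real.exp 2 * Real.exp (-(δ * R)) with hE
    have hE0 : 0 < E := by positivity
    have hEenv : ∀ s : ℝ, s ≤ 2 → Real.exp (-(δ * (R - s))) ≤ E := by
      intro s hs; rw [hE, ← Real.exp_add]; exact Real.exp_le_exp.mpr (by nlinarith)
    set U := lift (fine (n + 1) M) v x with hU
    -- distances: a point of the cube of radius `3m` around `x` is at `edist ≤ 1/2`
    have hcube : ∀ z ∈ cube (0 : Fin d → ℤ) (3 * m), edist n M x (liftPt (fine (n + 1) M) x z) ≤ 1 / 2 := by
      intro z hz
      rw [mem_cube_zero_iff] at hz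
      refine (edist_liftPt_le n M x z).trans ?_
      rw [div_le_iff₀ hn0]
      have : (supNorm z : ℝ) ≤ 3 * m := by exact_mod_cast hz
      have h8 : (8 : ℝ) * m ≤ (n : ℝ) + 1 := by exact_mod_cast h8m
      linarith
    -- (hA) the Laplacian bound on the cube
    set A : ℝ := (a * q * E + E) / ((n : ℝ) + 1) ^ 2 with hA
    have hAbd : ∀ z ∈ cube (0 : Fin d → ℤ) (3 * m), |latticeLaplacianZd U z| ≤ A := by
      intro z hz
      rw [hU, lap_lift]
      have hxz := hcube z hz
      have hR' : ∀ k, B5Blocks16.blockOf (n + 1) M k = B5Blocks16.blockOf (n + 1) M (liftPt (fine (n + 1) M) x z) →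
          ∀ t ∈ T, R - 3 / 2 ≤ edist n M k t := by
        intro k hk t ht
        have h1 := edist_triangle n M x (liftPt (fine (n + 1) M) x z) t
        have h2 := edist_triangle n M (liftPt (fine (n + 1) M) x z) k t
        have h3' := edist_same_block_le n M hk.symm
        linarith [hR t ht]
      refine (abs_lapT_G0_le n M h3 ha hδ0 hδ1 hsmall T hT g hg hg2 (liftPt (fine (n + 1) M) x z) (R - 3 / 2) hR').trans ?_
      rw [hA]
      apply div_le_div_of_nonneg_right _ (by positivity)
      have hgy : |g (liftPt (fine (n + 1) M) x z)| ≤ E := by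
        by_cases hyT : liftPt (fine (n + 1) M) x z ∈ T
        · have hRle : R ≤ 1 / 2 := (hR _ hyT).trans hxz
          calc |g (liftPt (fine (n + 1) M) x z)| ≤ 1 := hg1 _
            _ ≤ E := by
                rw [hE, ← Real.exp_add]; exact Real.one_le_exp (by nlinarith)
        · rw [hg _ hyT, abs_zero]; exact hE0.le
      have h1 : a * (2 / min 2 a) * Real.exp (-(δ * (R - 3 / 2))) ≤ a * q * E := by
        rw [← hq]; exact mul_le_mul_of_nonneg_left (hEenv (3 / 2) (by norm_num)) (by positivity)
      linarith [hgy]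
    -- (hB) the `ℓ¹` bound on the cube, through the injective parametrisation
    set B : ℝ := ((n : ℝ) + 1) ^ d * q * E with hB
    have hinj : Set.InjOn (liftPt (fine (n + 1) M) x) (cube (0 : Fin d → ℤ) (3 * m) : Set (Fin d → ℤ)) := by
      refine liftPt_injOn (fine (n + 1) M) x fun μ => ?_
      have hM1 : 1 ≤ M μ := Nat.one_le_iff_ne_zero.mpr (NeZero.ne _)
      calc 2 * (3 * m) + 1 ≤ n + 1 := by omega
        _ ≤ (n + 1) * M μ := Nat.le_mul_of_pos_right _ hM1
    have hBbd : (∑ z ∈ cube (0 : Fin d → ℤ) (3 * m), |U z|) ≤ B := by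
      rw [hU]
      have hsum : (∑ z ∈ cube (0 : Fin d → ℤ) (3 * m), |lift (fine (n + 1) M) v x z|) =
          ∑ y ∈ (cube (0 : Fin d → ℤ) (3 * m)).image (liftPt (fine (n + 1) M) x), |v y| := by
        rw [Finset.sum_image hinj]; rfl
      rw [hsum]
      have hS : (((cube (0 : Fin d → ℤ) (3 * m)).image (liftPt (fine (n + 1) M) x)).card : ℝ) ≤ ((n : ℝ) + 1) ^ d := by
        calc (((cube (0 : Fin d → ℤ) (3 * m)).image (liftPt (fine (n + 1) M) x)).card : ℝ)
            ≤ ((cube (0 : Fin d → ℤ) (3 * m)).card : ℝ) := by exact_mod_cast Finset.card_image_le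
          _ = ((2 * (3 * m) + 1 : ℕ) : ℝ) ^ d := by rw [card_cube]; push_cast; ring
          _ ≤ ((n : ℝ) + 1) ^ d := by
              apply pow_le_pow_left₀ (by positivity)
              have : ((2 * (3 * m) + 1 : ℕ) : ℝ) ≤ (n : ℝ) + 1 := by exact_mod_cast (show 2 * (3 * m) + 1 ≤ n + 1 by omega)
              exact this
      have hRS : ∀ y ∈ (cube (0 : Fin d → ℤ) (3 * m)).image (liftPt (fine (n + 1) M) x), ∀ t ∈ T, R - 1 / 2 ≤ edist n M y t := by
        intro y hy t ht
        obtain ⟨z, hz, rfl⟩ := Finset.mem_image.mp hy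
        have h1 := edist_triangle n M x (liftPt (fine (n + 1) M) x z) t
        linarith [hR t ht, hcube z hz]
      refine (sum_abs_G0_le n M h3 ha hδ0 hδ1 hsmall _ T hT hS (R - 1 / 2) hRS g hg hg2).trans ?_
      rw [hB, ← hq]
      exact mul_le_mul_of_nonneg_left (hEenv (1 / 2) (by norm_num)) (by positivity)
    -- the interior estimate
    obtain ⟨hval, hgrad⟩ := hC m hm1 U 0 A B hAbd hBbd
    have hU0 : U 0 = v x := lift_zero (fine (n + 1) M) v x
    -- arithmetic
    have h16d : ((n : ℝ) + 1) ^ d ≤ 16 ^ d * (m : ℝ) ^ d := by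
      rw [← mul_pow]; exact pow_le_pow_left₀ hn0.le h16R d
    have h16d1 : ((n : ℝ) + 1) ^ (d + 1) ≤ 16 ^ (d + 1) * (m : ℝ) ^ (d + 1) := by
      rw [← mul_pow]; exact pow_le_pow_left₀ hn0.le h16R (d + 1)
    have hmd : (0 : ℝ) < (m : ℝ) ^ d := by positivity
    have hkey : a * q + 1 + 16 ^ (d + 1) * q ≤ (1 + 16 ^ (d + 1)) * ((2 + a) * q) := by
      have e1 : (2 + a) * q = 2 * q + a * q := by ring
      have e2 : (16 : ℝ) ^ (d + 1) * q ≤ 16 ^ (d + 1) * ((2 + a) * q) :=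
        mul_le_mul_of_nonneg_left (by nlinarith [mul_nonneg ha.le hq0.le]) (by positivity)
      have e3 : (1 + (16 : ℝ) ^ (d + 1)) * ((2 + a) * q) = (2 + a) * q + 16 ^ (d + 1) * ((2 + a) * q) := by ring
      rw [e3]; linarith
    have hKC : 2 * (C * (1 + 16 ^ (d + 1)) * Real.exp 2) ≤ K := by
      have : 0 ≤ 2 * Real.exp 1 * (7 : ℝ) ^ (d + 1) := by positivity
      rw [hK]; linarith
    have h16dd : (16 : ℝ) ^ d ≤ 16 ^ (d + 1) := pow_le_pow_right₀ (by norm_num) (by omega)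
    constructor
    · -- value leg
      have hP : 0 ≤ a * q * E + E := by positivity
      have h1 : (m : ℝ) ^ 2 * A ≤ a * q * E + E := by
        rw [hA, ← mul_div_assoc, div_le_iff₀ (by positivity)]
        have : (m : ℝ) ^ 2 ≤ ((n : ℝ) + 1) ^ 2 := pow_le_pow_left₀ hm0.le hmR 2
        calc (m : ℝ) ^ 2 * (a * q * E + E) ≤ ((n : ℝ) + 1) ^ 2 * (a * q * E + E) :=
              mul_le_mul_of_nonneg_right this hP
          _ = _ := by ring
      have h2 : B / (m : ℝ) ^ d ≤ 16 ^ d * q * E := by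
        rw [hB, div_le_iff₀ hmd]
        calc ((n : ℝ) + 1) ^ d * q * E = ((n : ℝ) + 1) ^ d * (q * E) := by ring
          _ ≤ 16 ^ d * (m : ℝ) ^ d * (q * E) := mul_le_mul_of_nonneg_right h16d (by positivity)
          _ = _ := by ring
      calc |v x| = |U 0| := by rw [hU0]
        _ ≤ C * ((m : ℝ) ^ 2 * A + B / (m : ℝ) ^ d) := hval
        _ ≤ C * ((a * q * E + E) + 16 ^ d * q * E) := mul_le_mul_of_nonneg_left (add_le_add h1 h2) hC0
        _ ≤ C * ((1 + 16 ^ (d + 1)) * ((2 + a) * q) * E) := by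
            apply mul_le_mul_of_nonneg_left _ hC0
            have : (a * q * E + E) + 16 ^ d * q * E = (a * q + 1 + 16 ^ d * q) * E := by ring
            rw [this]
            apply mul_le_mul_of_nonneg_right _ hE0.le
            have : (16 : ℝ) ^ d * q ≤ 16 ^ (d + 1) * q := mul_le_mul_of_nonneg_right h16dd hq0.le
            linarith [hkey]
        _ = (C * (1 + 16 ^ (d + 1)) * Real.exp 2) * ((2 + a) * q * Real.exp (-(δ * R))) := by rw [hE]; ring
        _ = 2 * (C * (1 + 16 ^ (d + 1)) * Real.exp 2) * ((2 + a) / min 2 a) * Real.exp (-(δ * R)) := hKq _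
        _ ≤ K * ((2 + a) / min 2 a) * Real.exp (-(δ * R)) := by
            apply mul_le_mul_of_nonneg_right _ hX0.le
            exact mul_le_mul_of_nonneg_right hKC hfac
    · -- gradient leg
      intro μ
      have hUμ : U (Pi.single μ 1) = v (x + unitVec (fine (n + 1) M) μ) := lift_single (fine (n + 1) M) v x μ
      have hP : 0 ≤ a * q * E + E := by positivity
      have h1 : (m : ℝ) * A ≤ (a * q * E + E) / ((n : ℝ) + 1) := by
        rw [hA, ← mul_div_assoc, div_le_div_iff₀ (by positivity) hn0]
        have : (m : ℝ) * ((n : ℝ) + 1) ≤ ((n : ℝ) + 1) ^ 2 := by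
          rw [sq]; exact mul_le_mul_of_nonneg_right hmR hn0.le
        calc (m : ℝ) * (a * q * E + E) * ((n : ℝ) + 1) = (a * q * E + E) * ((m : ℝ) * ((n : ℝ) + 1)) := by ring
          _ ≤ (a * q * E + E) * ((n : ℝ) + 1) ^ 2 := mul_le_mul_of_nonneg_left this hP
      have h2 : B / (m : ℝ) ^ (d + 1) ≤ 16 ^ (d + 1) * q * E / ((n : ℝ) + 1) := by
        rw [hB, div_le_div_iff₀ (by positivity) hn0]
        calc ((n : ℝ) + 1) ^ d * q * E * ((n : ℝ) + 1) = ((n : ℝ) + 1) ^ (d + 1) * (q * E) := by ring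
          _ ≤ 16 ^ (d + 1) * (m : ℝ) ^ (d + 1) * (q * E) := mul_le_mul_of_nonneg_right h16d1 (by positivity)
          _ = _ := by ring
      calc |v (x + unitVec (fine (n + 1) M) μ) - v x| = |U (0 + Pi.single μ 1) - U 0| := by rw [zero_add, hUμ, hU0]
        _ ≤ C * ((m : ℝ) * A + B / (m : ℝ) ^ (d + 1)) := hgrad μ
        _ ≤ C * ((a * q * E + E) / ((n : ℝ) + 1) + 16 ^ (d + 1) * q * E / ((n : ℝ) + 1)) :=
            mul_le_mul_of_nonneg_left (add_le_add h1 h2) hC0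
        _ ≤ C * ((1 + 16 ^ (d + 1)) * ((2 + a) * q) * E / ((n : ℝ) + 1)) := by
            apply mul_le_mul_of_nonneg_left _ hC0
            rw [← add_div]
            apply div_le_div_of_nonneg_right _ hn0.le
            have : (a * q * E + E) + 16 ^ (d + 1) * q * E = (a * q + 1 + 16 ^ (d + 1) * q) * E := by ring
            rw [this]
            exact mul_le_mul_of_nonneg_right hkey hE0.le
        _ = 2 * (C * (1 + 16 ^ (d + 1)) * Real.exp 2) * ((2 + a) / min 2 a) / ((n : ℝ) + 1) * Real.exp (-(δ * R)) := by
            rw [hE, hq]; ring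
        _ ≤ K * ((2 + a) / min 2 a) / ((n : ℝ) + 1) * Real.exp (-(δ * R)) := by
            apply mul_le_mul_of_nonneg_right _ hX0.le
            apply div_le_div_of_nonneg_right _ hn0.le
            exact mul_le_mul_of_nonneg_right hKC hfac

end Main

/-! ## §4 The block-source legs at the standard rate, and non-vacuity at `d = 4` -/

section Block

variable {d : ℕ}

/-- **Block-source transport legs at the standard Combes–Thomas rate `δ_std(d,a) = min(2,a)/(4(d+a+1))`.**
For `u_b = G₀ 1_{B(b)}` (the `G₀`-potential of ONE block indicator) and every site `x` at `edist ≥ R` from the block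
`B(b)`:  `|u_b(x)| ≤ K(d)·(2+a)/min(2,a)·e^{−δ_std R}` and `|u_b(x+e_μ) − u_b(x)| ≤ K(d)·(2+a)/min(2,a)·(n+1)⁻¹·e^{−δ_std R}`,
uniformly in the mesh `n`, the volume `M` and — through the explicit factor `(2+a)/min(2,a)` — locally uniformly in
`a ∈ (0,∞)`. [folklore] -/
theorem block_legs (hd : 3 ≤ d) : ∃ K : ℝ, 0 ≤ K ∧
    ∀ (n : ℕ) (M : Fin d → ℕ) [∀ μ, NeZero (M μ)], (∀ μ, 3 ≤ fine (n + 1) M μ) →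
    ∀ (a : ℝ), 0 < a → ∀ (b : Tor M) (x : Tor (fine (n + 1) M)) (R : ℝ),
      (∀ t, B5Blocks16.blockOf (n + 1) M t = b → R ≤ edist n M x t) →
      |(G0 n M a).mulVec (fun k => if B5Blocks16.blockOf (n + 1) M k = b then (1 : ℝ) else 0) x|
          ≤ K * ((2 + a) / min 2 a) * Real.exp (-(deltaStd d a * R)) ∧
      ∀ μ : Fin d,
        |(G0 n M a).mulVec (fun k => if B5Blocks16.blockOf (n + 1) M k = b then (1 : ℝ) else 0)
              (x + unitVec (fine (n + 1) M) μ) -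
            (G0 n M a).mulVec (fun k => if B5Blocks16.blockOf (n + 1) M k = b then (1 : ℝ) else 0) x|
          ≤ K * ((2 + a) / min 2 a) / ((n : ℝ) + 1) * Real.exp (-(deltaStd d a * R)) := by
  obtain ⟨K, hK0, hK⟩ := transport_legs (d := d) hd
  refine ⟨K, hK0, ?_⟩
  intro n M _ h3 a ha b x R hR
  have hT : ∀ y, y ∉ univ.filter (fun k => B5Blocks16.blockOf (n + 1) M k = b) →
      (fun k => if B5Blocks16.blockOf (n + 1) M k = b then (1 : ℝ) else 0) y = 0 := by
    intro y hy
    simp only [mem_filter, mem_univ, true_and] at hy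
    simp [hy]
  have h1 : ∀ y, |(fun k => if B5Blocks16.blockOf (n + 1) M k = b then (1 : ℝ) else 0) y| ≤ 1 := by
    intro y; simp only; split_ifs <;> simp
  have h2 : ∑ y, (fun k => if B5Blocks16.blockOf (n + 1) M k = b then (1 : ℝ) else 0) y ^ 2 ≤ ((n : ℝ) + 1) ^ d := by
    simp only
    rw [sum_blockInd_sq, card_block]; push_cast; exact le_rfl
  exact hK n M h3 a (deltaStd d a) ha (deltaStd_pos ha).le (deltaStd_le_one ha) (deltaStd_small ha) _ _ hT h1 h2
    x R (fun t ht => hR t (mem_filter.mp ht).2)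

/-- Non-vacuity in the physical dimension `d = 4`. [folklore] -/
example : ∃ K : ℝ, 0 ≤ K ∧
    ∀ (n : ℕ) (M : Fin 4 → ℕ) [∀ μ, NeZero (M μ)], (∀ μ, 3 ≤ fine (n + 1) M μ) →
    ∀ (a : ℝ), 0 < a → ∀ (b : Tor M) (x : Tor (fine (n + 1) M)) (R : ℝ),
      (∀ t, B5Blocks16.blockOf (n + 1) M t = b → R ≤ edist n M x t) →
      |(G0 n M a).mulVec (fun k => if B5Blocks16.blockOf (n + 1) M k = b then (1 : ℝ) else 0) x|
          ≤ K * ((2 + a) / min 2 a) * Real.exp (-(deltaStd 4 a * R)) ∧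
      ∀ μ : Fin 4,
        |(G0 n M a).mulVec (fun k => if B5Blocks16.blockOf (n + 1) M k = b then (1 : ℝ) else 0)
              (x + unitVec (fine (n + 1) M) μ) -
            (G0 n M a).mulVec (fun k => if B5Blocks16.blockOf (n + 1) M k = b then (1 : ℝ) else 0) x|
          ≤ K * ((2 + a) / min 2 a) / ((n : ℝ) + 1) * Real.exp (-(deltaStd 4 a * R)) :=
  block_legs (by norm_num)

/-- The smallness condition is met by a POSITIVE rate at `d = 4`, `a = 1`: `δ_std(4,1) = 1/24`. [folklore] -/
example : deltaStd 4 1 = 1 / 24 := by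
  unfold EffectiveKernel.deltaStd; norm_num

end Block

end

end Literature.MathematicalPhysics.QuantumFieldTheory.Balaban1983to89.Beta.TransportLeg
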